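import Literature.MathematicalPhysics.QuantumFieldTheory.Balaban1983to89.B6Cor28PrintedKLevelV1
import Literature.MathematicalPhysics.QuantumFieldTheory.Balaban1983to89.B6Ineq2137GradKLevelV1
import HarnessLib

/-!
# `Balaban1983to89.B6Cor28HolderUnifKLevelV1` — T. Bałaban, *Propagators and renormalization transformations for lattice gauge theories. II*,
Comm. Math. Phys. **96** (1984) 223–250 [Balaban1984PropagatorsII], **Corollary 2.8 (2.150)–(2.151) p. 249 AT k LEVELS for the genuine
`H = GQ*(QGQ*)⁻¹`, HYPOTHESIS-FREE** (B6-CLOSURE §5 item 20, sequel; owner r03): the ONE displayed input `h2137` of `B6Cor28HolderKLevelV1.cor28_kLevel_holderPair_of_2137`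
and of the census `B6Cor28PrintedKLevelV1.cor28Printed_kLevel_of_2137` — Prop. 2.6 (2.137)₁ `‖ζ∇GJ‖_α` at k levels for the genuine `G = Δ_a⁻¹`, «M sufficiently
large» UNIFORM in the Hölder exponent — is DISCHARGED BY NAME from p22's k-level (2.137)₁ programme: the Hölder first legs of the walk (2.141) for every cube
`B6Ineq2137GradKLevelV1.holderLegs_kLevel` (rate `ρ_H` free of `α`, constant `C_H(α)`) fed to `B6Prop26HolderGradKLevelV1.prop26_2137_grad_kLevel_of_legs`
(whose `A`, `M₂` are chosen for `σ, β` before any `α`), giving the quantifier order `∃σ₁ ∀σ ∀β ∃M₂ ∀α ∃A` the censuses `B6.Prop26Printed` / `B6.Cor28Printed`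
need (ONE threshold before the exponent; p22's own assembled `ineq2137_grad_kLevel` reads `∀α … ∃M₂`).

HONEST FRAMING (programme rule): statement-level skeleton of published theorems with citation tags; proofs where landed; nothing here
is a claim about the Yang–Mills mass gap.

## WHAT THIS FILE CERTIFIES (kernel-checked, sorry-free, standard axioms; THEOREMS ONLY)

* `ineq2137_grad_kLevel_unif` = PROP. 2.6 (2.137)₁ at k levels for the genuine `G`, per admissible pair of fine bonds, threshold uniform in the Hölder
  exponent (= the statement of the displayed input `h2137`, verbatim), from p22's `holderLegs_kLevel` + `prop26_2137_grad_kLevel_of_legs` BY NAME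
  (p22's §3 proof, re-ordered);
* **`cor28_kLevel_holderPair`** = Cor. 2.8 (2.151)₃ pair differences at k levels for the genuine `H`, NO displayed input
  (`cor28_kLevel_holderPair_of_2137` fed with `ineq2137_grad_kLevel_unif`);
* **`cor28Printed_kLevel (hb₀) (hb₁) : B6.Cor28Printed (d + 1) (fun i : KIdx d ℓ hd hL b₀ b₁ => kGeo i) (fun i => kH i)`** — THE VERBATIM CENSUS TYPING OF
  COROLLARY 2.8 INHABITED ON THE GENUINE k-LEVEL V1 FAMILY WITH NO HYPOTHESIS beyond the band `0 < b₀ ≤ b₁`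
  (`cor28Printed_kLevel_of_2137` fed with `ineq2137_grad_kLevel_unif`); non-vacuity: `B6Prop27PrintedKLevelV1.kLevel27_meets_hypotheses`.

## HONEST SCOPE

As in `B6Cor28PrintedKLevelV1` (family = the V1 torus family of ROUTE V/W, `k ≥ 2`; flat `ℓ²` entries; `δ₅`, `C`, `Cα` ours on `d, L, b₀, b₁`; the
expansion form of `H` not re-derived) and `B6Ineq2137GradKLevelV1` (admissible pairs = p22's symmetric pair condition).  NOT summit progress.
Unit `lit-balaban-r03` (gen 26), 2026-08-25.
-/

namespace Literature.MathematicalPhysics.QuantumFieldTheory.Balaban1983to89.B6Cor28HolderUnifKLevelV1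

open scoped InnerProductSpace
open LatticeFieldCalculus
open B6SectAOperatorsV1 (QE QsE BondIdx BondIdxSpace)
open B6SectAVectorModelV1 (GE EE)
open B6Ineq2133TwoScaleV1 (onFun)
open B6RandomWalk (HasMajorant delta3)
open B6MultiLevelBoxOperator (N0)
open B6MultiLevelTorusOperator (TDomains)
open B6GlobalChartV1 (PV domT blkV1)
open B6Geom246MultiLevelTorus (geomT)
open B8Ineq192MultiLevelTorus (geomT_len)
open B6Ineq2142KLevelV1 (lvl β)
open B6GradLegKLevelV1 (DV)
open B6HolderPairMemberV1 (pairOp)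
open B6Ineq2137GradKLevelV1 (holderLegs_kLevel)
open B6Prop26HolderGradKLevelV1 (prop26_2137_grad_kLevel_of_legs)
open B6CubeWindowV1 (Placed GlobalBand)
open B6Cover236MultiLevelBlocks (cubes)
open B6KLevelCensusIndexV1 (KIdx kGeo)
open B6Cor28HolderKLevelV1 (cor28_kLevel_holderPair_of_2137)
open B6Cor28PrintedKLevelV1 (kH cor28Printed_kLevel_of_2137)

noncomputable section

open Classical in
/-- **[B6] PROPOSITION 2.6 (2.137)₁ `‖ζ∇GJ‖_α` AT k LEVELS FOR THE GENUINE `G = Δ_a⁻¹`, THE «M SUFFICIENTLY LARGE» THRESHOLD UNIFORM IN THE HÖLDER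
EXPONENT** — p22's `B6Ineq2137GradKLevelV1.ineq2137_grad_kLevel` (its `HasMajorant` conjunct, binders verbatim) re-assembled from p22's OWN two
ingredients BY NAME in the quantifier order `∃σ₁ ∀σ ∀β ∃M₂ ∀α ∃A`: the Hölder first legs of the walk (2.141) for every cube
`B6Ineq2137GradKLevelV1.holderLegs_kLevel` (rate `ρ_H` free of `α`, constant `C_H(α)`) fed to `B6Prop26HolderGradKLevelV1.prop26_2137_grad_kLevel_of_legs`
(whose `A`, `M₂` are chosen for `σ, β` before any `α`); for every admissible pair of fine bonds `x, x′` (same direction, `|x − x′|_∞ ≤ L^{j(y(x))}`,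
`≤ L^{j(y(x′))}`), `t := |x − x′|_∞/L^{j(y(x))}`: `HasMajorant (P_{x,x′}·∇_ν·onFun G) (A·t^α·(L^{j(y)}·|c′|⁻¹)·e^{−δ₃d_T(y,y′)})`, `δ₃ = delta3 β (2σ)` —
print's `|x − x′|^{−α}|(∇GJ)(x) − (∇GJ)(x′)| ≤ O(1)(Lʲη)^{1−α}e^{−δ₃d(y,y′)}|J|`, «M sufficiently large» independent of `α` (as the census typings
`B6.Prop26Printed`/`B6.Cor28Printed` choose ONE threshold `M₁` before the exponent).
[cite: Balaban1984PropagatorsII, Prop. 2.6 (2.137) p.247, (2.141) p.247, (2.66) p.234; Balaban1984PropagatorsI, (1.109) p.35] -/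
theorem ineq2137_grad_kLevel_unif (d ℓ : ℕ) (hd : 1 ≤ d + 1) (hL : Odd (ℓ + 1) ∧ 1 < ℓ + 1) {b₀ b₁ : ℝ} (hb₀ : 0 < b₀) (hb₁ : b₀ ≤ b₁) :
    ∃ σ₁ : ℝ, 0 < σ₁ ∧ ∀ (σ : ℝ), 0 < σ → σ ≤ σ₁ → ∀ (β : ℝ), 0 < β → β ≤ 1 → ∃ M₂ : ℝ, 0 < M₂ ∧ ∀ (α : ℝ), 0 ≤ α → α < 1 →
    ∃ A : ℝ, 0 ≤ A ∧
    ∀ (m K : ℕ) {Mh k R : ℕ} {P' : Fin (d + 1) → ℕ}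
      (hN : ∀ μ, N0 ℓ Mh k P' μ = (PV d ℓ m K hd hL).sitesPerDir 0) (D : TDomains d ℓ Mh k P' R) (hk : k ≤ m + K) (_ : 2 ≤ k)
      {a : ℕ} (_ : Mh = (ℓ + 1) ^ a) (_ : 8 ≤ Mh) (_ : 2 * (ℓ + 1) ^ 2 ≤ R) (_ : ∀ μ, 5 ≤ P' μ) (_ : 4 ≤ ℓ)
      (_ : ∀ c : ↥(cubes D.toDomains), Placed ℓ k P' c.1) (_ : M₂ ≤ ((ℓ : ℝ) + 1) * Mh)
      {cf : ℝ} (hcf : cf ≠ 0) {w : BondIdx (domT hN D hk) → ℝ} (hw : ∀ i, 0 < w i) (_ : GlobalBand b₀ b₁ cf w)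
      (ν : Fin (d + 1)) (x x' : PBond (PV d ℓ m K hd hL) 0), x.dir = x'.dir →
      supDist x.src x'.src ≤ (ℓ + 1) ^ (blkV1 hN D x).1.1 → supDist x.src x'.src ≤ (ℓ + 1) ^ (blkV1 hN D x').1.1 →
      HasMajorant (g := geomT D) (blkV1 hN D) (pairOp x x' * DV (P := PV d ℓ m K hd hL) ν cf * onFun (GE (domT hN D hk) hcf hw))
          (fun y y' => A * ((((supDist x.src x'.src : ℕ) : ℝ) / (((ℓ + 1 : ℕ) : ℝ)) ^ (blkV1 hN D x).1.1) ^ α *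
            ((geomT D).len y * |cf|⁻¹)) * Real.exp (-(delta3 β (2 * σ) * (geomT D).dist y y'))) := by
  obtain ⟨ρH, hρH, hlegs⟩ := holderLegs_kLevel d ℓ hd hL hb₀ hb₁
  obtain ⟨σ₁, hσ₁, -, h⟩ := prop26_2137_grad_kLevel_of_legs d ℓ hd hL hb₀ hb₁ hρH
  refine ⟨σ₁, hσ₁, fun σ hσ hσ1 β hβ hβ1 => ?_⟩
  obtain ⟨A, M₂, hA, hM₂, h2⟩ := h σ hσ hσ1 β hβ hβ1
  refine ⟨M₂, hM₂, fun α hα0 hα1 => ?_⟩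
  obtain ⟨CH, hCH, hlegs'⟩ := hlegs α hα0 hα1
  refine ⟨A * CH, mul_nonneg hA hCH, ?_⟩
  intro m K Mh k R P' hN D hk hk2 a hMha hM8 hR2 hP5 hℓ hpl hM cf hcf w hw hwb ν x x' hdir hs1 hs2
  have hPw : ∀ y : (geomT D).Site, 0 ≤ (((supDist x.src x'.src : ℕ) : ℝ) / (((ℓ + 1 : ℕ) : ℝ)) ^ (blkV1 hN D x).1.1) ^ α *
      ((geomT D).len y * |cf|⁻¹) := fun y => by
    have : 0 ≤ (geomT D).len y * |cf|⁻¹ := by rw [geomT_len]; positivity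
    exact mul_nonneg (Real.rpow_nonneg (by positivity) _) this
  exact (h2 m K hN D hk hk2 hMha hM8 hR2 hP5 hℓ hpl hM hcf hw hwb ν x x' CH
    (fun y => (((supDist x.src x'.src : ℕ) : ℝ) / (((ℓ + 1 : ℕ) : ℝ)) ^ (blkV1 hN D x).1.1) ^ α * ((geomT D).len y * |cf|⁻¹)) hCH hPw
    (fun c => hlegs' m K hN D hk hMha hM8 hR2 hP5 hℓ c (hpl c) w hcf ν x x' hdir hs1 hs2)).1

open Classical in
/-- **[B6] COROLLARY 2.8, THE HÖLDER ENTRY (2.151)₃ — PAIR DIFFERENCES — AT k LEVELS FOR THE GENUINE `H`, HYPOTHESIS-FREE**: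
`B6Cor28HolderKLevelV1.cor28_kLevel_holderPair_of_2137` with its displayed (2.137)₁ input discharged by `ineq2137_grad_kLevel_unif`.
[cite: Balaban1984PropagatorsII, Cor. 2.8 (2.150)–(2.151) p.249, Prop. 2.6 (2.137) p.247, Prop. 2.7 (2.147)–(2.149) p.248–249] -/
theorem cor28_kLevel_holderPair (d ℓ : ℕ) (hd : 1 ≤ d + 1) (hL : Odd (ℓ + 1) ∧ 1 < ℓ + 1) {b₀ b₁ : ℝ} (hb₀ : 0 < b₀) (hb₁ : b₀ ≤ b₁) :
    ∃ σ₁ : ℝ, 0 < σ₁ ∧ ∀ (σ : ℝ), 0 < σ → σ ≤ σ₁ → ∀ (αr : ℝ), 0 < αr → αr < 1 →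
    ∃ (δ₅ M₂ : ℝ) (N₁ : ℕ), 0 < δ₅ ∧ 0 < M₂ ∧ ∀ (α : ℝ), 0 ≤ α → α < 1 → ∃ C : ℝ, 0 ≤ C ∧
    ∀ (m K : ℕ) {Mh k R : ℕ} {P' : Fin (d + 1) → ℕ}
      (hN : ∀ μ, N0 ℓ Mh k P' μ = (PV d ℓ m K hd hL).sitesPerDir 0) (D : TDomains d ℓ Mh k P' R) (hk : k ≤ m + K) (_ : 2 ≤ k)
      {a : ℕ} (_ : Mh = (ℓ + 1) ^ a) (_ : 8 ≤ Mh) (_ : 2 * (ℓ + 1) ^ 2 ≤ R) (_ : ∀ μ, 5 ≤ P' μ) (_ : 4 ≤ ℓ)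
      (_ : ∀ c : ↥(cubes D.toDomains), Placed ℓ k P' c.1) (_ : M₂ ≤ ((ℓ : ℝ) + 1) * Mh) (_ : N₁ + 1 ≤ R * ((ℓ + 1) * Mh))
      {cf : ℝ} (hcf : cf ≠ 0) {w : BondIdx (domT hN D hk) → ℝ} (hw : ∀ i, 0 < w i) (_ : GlobalBand b₀ b₁ cf w)
      (ν : Fin (d + 1)) (x x' : PBond (PV d ℓ m K hd hL) 0), x.dir = x'.dir →
      supDist x.src x'.src ≤ (ℓ + 1) ^ (blkV1 hN D x).1.1 → supDist x.src x'.src ≤ (ℓ + 1) ^ (blkV1 hN D x').1.1 →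
      ∀ c : BondIdx (domT hN D hk),
      |(DV (P := PV d ℓ m K hd hL) ν cf ∘ₗ onFun (GE (domT hN D hk) hcf hw ∘ₗ QsE (domT hN D hk) ∘ₗ EE (domT hN D hk) hcf hw)) (Pi.single c 1) x -
        (DV (P := PV d ℓ m K hd hL) ν cf ∘ₗ onFun (GE (domT hN D hk) hcf hw ∘ₗ QsE (domT hN D hk) ∘ₗ EE (domT hN D hk) hcf hw)) (Pi.single c 1) x'| ≤
        C * ((((supDist x.src x'.src : ℕ) : ℝ) / (((ℓ + 1 : ℕ) : ℝ)) ^ (blkV1 hN D x).1.1) ^ α *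
          ((geomT D).len (blkV1 hN D x) * |cf|⁻¹)⁻¹) * Real.exp (-(δ₅ * (geomT D).dist (blkV1 hN D x) (β hN D hk c))) :=
  cor28_kLevel_holderPair_of_2137 d ℓ hd hL hb₀ hb₁ (ineq2137_grad_kLevel_unif d ℓ hd hL hb₀ hb₁)

variable {d ℓ : ℕ} {hd : 1 ≤ d + 1} {hL : Odd (ℓ + 1) ∧ 1 < ℓ + 1} {b₀ b₁ : ℝ} in
/-- **COROLLARY 2.8 (2.150)–(2.151), VERBATIM (`B6.Cor28Printed (d+1)`), ON THE GENUINE k-LEVEL V1 FAMILY WITH NO HYPOTHESIS** beyond the band: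
`B6Cor28PrintedKLevelV1.cor28Printed_kLevel_of_2137` with its displayed (2.137)₁ input discharged by `ineq2137_grad_kLevel_unif`.
[cite: Balaban1984PropagatorsII, Cor. 2.8 (2.150)–(2.151) p.249, Prop. 2.6 (2.137) p.247] -/
theorem cor28Printed_kLevel (hb₀ : 0 < b₀) (hb₁ : b₀ ≤ b₁) :
    B6.Cor28Printed (d + 1) (fun i : KIdx d ℓ hd hL b₀ b₁ => kGeo i) (fun i => kH i) :=
  cor28Printed_kLevel_of_2137 hb₀ hb₁ (ineq2137_grad_kLevel_unif d ℓ hd hL hb₀ hb₁)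

end

end Literature.MathematicalPhysics.QuantumFieldTheory.Balaban1983to89.B6Cor28HolderUnifKLevelV1
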